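import Summits.AtomisticToContinuum.Crystallization.Theorems.FreeSplittingCertificatesStrictSplittingRuleDeficitBound

/-!
# `StrictSplittingRule` (stmt-AtomisticToContinuum-12560): the crux is trivial at large hard core

Support file of crux line `birth` (lead): WHERE THE CONTENT OF THE CRUX LIVES.  For hard cores `δ ≥ 4`
(indeed `δ⁶ ≥ 1000` suffices) the inner statement of `StrictSplittingRule` holds for the trivial reason
that `δ`-separated configurations are energetically dilute: every weighted site energy of EVERY rule is
`≥ −(250/6)·δ⁻⁶ > −1/24 ≥ e_∞` (`e_∞ ≤ E(2)/2 = V_LJ(1)/2 = −1/24`), so the even split `Φ ≡ 1/2` is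
feasible and strictness is vacuous with `c := 1/24 − (250/6)δ⁻⁶ > 0` (no site ever has weighted energy
`< e_∞ + c`).  Hence `StrictSplittingRule` is equivalent to its restriction to `δ < 4` — in fact to any
one sequence `δₙ → 0`, by monotonicity in `δ` (`strictInner_mono`): the crux is a statement about the
hard-core regime `δ ≤ a* ≈ 0.97` only.  Registered anchor: `stub_largeCoreTrivial`.  All [folklore].
-/

noncomputable section

namespace Summit.AtomisticToContinuum.Crystallization.Theorems.StrictSplittingRuleBirth

open scoped BigOperators Classical
open Literature.MathematicalPhysics.StatisticalMechanics
open Literature.Geometry.DiscreteGeometry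

/-- Euclidean `3`-space. -/
local notation "E3" => EuclideanSpace ℝ (Fin 3)

/-- The inner statement of the crux at hard core `δ` (definitionally the body of `StrictSplittingRule`
after `∀ δ > 0`). -/
theorem strictInner_iff (δ : ℝ) :
    (∃ (R : ℝ) (Φ : E3 → Finset E3 → ℝ) (a t : ℝ), 0 < R ∧ 0 < a ∧ |t| ≤ 1 / 100 ∧
        IsRule Φ ∧ Feasible δ R Φ ∧ Strict δ R Φ a t) ↔
      (∃ (R : ℝ) (Φ : E3 → Finset E3 → ℝ) (a t : ℝ), 0 < R ∧ 0 < a ∧ |t| ≤ 1 / 100 ∧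
        IsRule Φ ∧ Feasible δ R Φ ∧ Strict δ R Φ a t) :=
  Iff.rfl

/-- **Monotonicity in the hard core**: a rule that works at hard core `δ` works at every `δ' ≥ δ`
(`δ'`-separated configurations are `δ`-separated). -/
theorem strictInner_mono {δ δ' : ℝ} (hδ : δ ≤ δ') {R : ℝ} {Φ : E3 → Finset E3 → ℝ} {a t : ℝ}
    (hF : Feasible δ R Φ) (hS : Strict δ R Φ a t) : Feasible δ' R Φ ∧ Strict δ' R Φ a t := by
  have hsep : ∀ {N : ℕ} (x : Fin N → E3), Sep δ' x → Sep δ x := fun x hx i j hij =>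
    le_trans hδ (hx i j hij)
  refine ⟨fun N x hx i => hF N x (hsep x hx) i, fun η hη => ?_⟩
  obtain ⟨c, hc, h⟩ := hS η hη
  exact ⟨c, hc, fun N x hx k hk => h N x (hsep x hx) k hk⟩

/-- `e_∞ ≤ −1/24`: Fekete's constant is at most `E(2)/2`, and two particles at distance `1` have energy
`V_LJ(1) = −1/12`. -/
theorem eInf_le_neg_one_div : eInf ≤ -(1 / 24) := by
  obtain ⟨e, -, -, he⟩ := BlancLewin2015_8_holds 3 (by norm_num) (by norm_num)
  have hbdd : BddBelow (Set.range fun M : ℕ =>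
      groundStateEnergy lennardJones 3 (M + 1) / ((M + 1 : ℕ) : ℝ)) := by
    refine ⟨e, ?_⟩
    rintro _ ⟨M, rfl⟩
    exact he (M + 1) M.succ_pos
  have h := ciInf_le hbdd 1
  -- two points at distance 1
  set x : Fin 2 → E3 := ![0, EuclideanSpace.single 0 1] with hx
  have h01 : dist (x 0) (x 1) = 1 := by
    simp [hx, dist_eq_norm]
  have hne : x 0 ≠ x 1 := fun h => by
    have : dist (x 0) (x 1) = 0 := by rw [h, dist_self]
    rw [h01] at this; norm_num at this
  have hinj : Function.Injective x := by
    intro i j hij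
    fin_cases i <;> fin_cases j
    · rfl
    · exact absurd hij hne
    · exact absurd hij.symm hne
    · rfl
  have hE : interactionEnergy lennardJones x = -(1 / 12) := by
    unfold interactionEnergy
    rw [Fin.sum_univ_two]
    have h0 : Finset.Ioi (0 : Fin 2) = {1} := by decide
    have h1 : Finset.Ioi (1 : Fin 2) = ∅ := by decide
    rw [h0, h1, Finset.sum_singleton, Finset.sum_empty, h01, lennardJones_one]
    norm_num
  have hle : groundStateEnergy lennardJones 3 2 ≤ -(1 / 12) :=
    hE ▸ groundStateEnergy_lennardJones_le hinj
  have h2 : groundStateEnergy lennardJones 3 (1 + 1) / ((1 + 1 : ℕ) : ℝ) ≤ -(1 / 24) := by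
    rw [show (1 + 1 : ℕ) = 2 from rfl]
    push_cast
    linarith
  unfold eInf
  exact h.trans h2

/-- Every weighted site energy of every rule on a `δ`-separated configuration is `≥ −(250/6) δ⁻⁶`. -/
theorem siteE_ge_neg_of_sep {δ : ℝ} (hδ : 0 < δ) (R : ℝ) {Φ : E3 → Finset E3 → ℝ} (hΦ : IsRule Φ)
    {N : ℕ} {x : Fin N → E3} (hsep : Sep δ x) (k : Fin N) :
    -(250 / 6 * δ⁻¹ ^ 6) ≤ siteE R Φ x k := by
  have hsum : ∑ j ∈ Finset.univ.erase k, (dist (x k) (x j))⁻¹ ^ 6 ≤ 250 * δ⁻¹ ^ 6 :=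
    sum_inv_pow_six_le x hδ hsep k
  unfold siteE
  calc -(250 / 6 * δ⁻¹ ^ 6)
      ≤ -((1 / 6) * ∑ j ∈ Finset.univ.erase k, (dist (x k) (x j))⁻¹ ^ 6) := by linarith
    _ = ∑ j ∈ Finset.univ.erase k, -((1 / 6) * (dist (x k) (x j))⁻¹ ^ 6) := by
        rw [Finset.mul_sum, ← Finset.sum_neg_distrib]
    _ ≤ _ := Finset.sum_le_sum fun j _ => deficitBound_term _ (hΦ.1 _ _).1 (hΦ.1 _ _).2

/-- **The crux is trivial at large hard core**: for `δ ≥ 4` the even split `Φ ≡ 1/2` at any radius is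
feasible on `δ`-separated configurations and (vacuously) strict toward `S(1,0)`. -/
theorem strictInner_of_four_le {δ : ℝ} (hδ : 4 ≤ δ) :
    ∃ (R : ℝ) (Φ : E3 → Finset E3 → ℝ) (a t : ℝ), 0 < R ∧ 0 < a ∧ |t| ≤ 1 / 100 ∧
      IsRule Φ ∧ Feasible δ R Φ ∧ Strict δ R Φ a t := by
  have hδ0 : 0 < δ := by linarith
  have hpow : δ⁻¹ ^ 6 ≤ 4⁻¹ ^ 6 := by
    apply pow_le_pow_left₀ (by positivity)
    exact (inv_le_inv₀ hδ0 (by norm_num)).2 hδ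
  have hsmall : 250 / 6 * δ⁻¹ ^ 6 < 1 / 24 := by
    have : (4:ℝ)⁻¹ ^ 6 = 1 / 4096 := by norm_num
    nlinarith
  refine ⟨1, fun _ _ => 1 / 2, 1, 0, one_pos, one_pos, by norm_num, stub_defs, ?_, ?_⟩
  · intro N x hx i
    have := siteE_ge_neg_of_sep hδ0 1 stub_defs hx i
    linarith [eInf_le_neg_one_div]
  · intro η _
    refine ⟨1 / 24 - 250 / 6 * δ⁻¹ ^ 6, by linarith, ?_⟩
    intro N x hx k hk
    have := siteE_ge_neg_of_sep hδ0 1 stub_defs hx k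
    linarith [eInf_le_neg_one_div]

/-- **Registered anchor `stub_largeCoreTrivial`**: `StrictSplittingRule` holds when restricted to hard
cores `δ ≥ 4` (so the crux is equivalent to its restriction to `δ < 4`, by `strictInner_mono`). -/
theorem stub_largeCoreTrivial : ∀ δ : ℝ, 4 ≤ δ →
    ∃ (R : ℝ) (Φ : E3 → Finset E3 → ℝ) (a t : ℝ), 0 < R ∧ 0 < a ∧ |t| ≤ 1 / 100 ∧
      IsRule Φ ∧ Feasible δ R Φ ∧ Strict δ R Φ a t :=
  fun _ hδ => strictInner_of_four_le hδ

end Summit.AtomisticToContinuum.Crystallization.Theorems.StrictSplittingRuleBirth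

end
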